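import Literature.Computability.Complexity.OccurrenceObstructions
import Literature.Computability.AlgebraicComplexity.MultiplicityObstructionsProofs
import Literature.NumberTheory.DiophantineGeometry.SchurWeylPlethysmRenameProofs
import HarnessLib

/-!
# The occurrence-obstruction principle: discharge of
# `Literature.Computability.Complexity.not_hasBorderDetRepr_of_hasHighestWeight_of_not`

Sibling proofs file of `Literature/Computability/Complexity/OccurrenceObstructions.lean`. It proves
the named fact `Literature.Computability.Complexity.not_hasBorderDetRepr_of_hasHighestWeight_of_not` of that file (the
*occurrence-obstruction principle* of geometric complexity theory, in the tree's weight form over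
`ℂ`): if an irreducible `V(χ)` of `GL_{m²}(ℂ)` occurs in the coordinate ring
`ℂ[Z] = ℂ[\overline{GL · X₀₀^{m-n} per_n}]` but not in `ℂ[Ω] = ℂ[\overline{GL · det_m}]`, then
`X₀₀^{m-n} per_n ∉ Ω`, i.e. `¬ HasBorderDetRepr ℂ n m`; together with its predicate form
`Literature.Computability.Complexity.IsOccurrenceObstruction.not_hasBorderDetRepr` and the consequence
`Literature.Computability.Complexity.mulmuleySohoni_of_occurrenceObstructionRoute` (both named facts of the same file, whose
preserved interim proofs only used the principle). The remaining consequences of that file rest on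
facts not proved in this file's imports — `not_isOccurrenceObstruction` and
`not_occurrenceObstructionRoute` on BIP's Theorem 1.4 (`no_occurrence_obstructions`), and
`lt_borderDetComplexityPer_of_occurrence_obstruction` on the nonemptiness fact
`CplxAlg.exists_hasBorderDetRepr` of `OrbitClosure.lean` (Valiant universality); their preserved
interim proofs are recorded here in conditional form (`…_of_no_occurrence_obstructions`,
`…_of_exists`).

Printed proof (Bürgisser–Ikenmeyer–Panova 2019 §1, arXiv:1604.06431v3 p. 3): "If the latter is
contained in `Ω_n`, then `Z_{n,m} ⊆ Ω_n`, and the restriction defines a surjective `G`-equivariant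
homomorphism `ℂ[Ω_n] → ℂ[Z_{n,m}]` of the coordinate rings. Schur's lemma implies that if `λ`
occurs in `ℂ[Z_{n,m}]`, then it must also occur in `ℂ[Ω_n]`. A partition `λ` violating this
condition is called an occurrence obstruction. Its existence thus proves that `Z_{n,m} ⊄ Ω_n`"
("The coordinate ring `ℂ[Ω_n]` is a direct sum of its irreducible submodules since `G` is
reductive", ibid.); the same in Bürgisser–Landsberg–Manivel–Weyman 2011 §1 (arXiv:0907.2850 p. 3:
"one has `X ⊂ Y` iff `ℂ[Y]` surjects onto `ℂ[X]` by restriction of polynomial functions ...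
a straightforward consequence ... by Schur's lemma"; Prop. 3.3.2 in the SIAM numbering cited by
`OccurrenceObstructions.lean`), and in Bläser–Ikenmeyer 2025
§12.4 (p. 74: "`I(Z)_δ ⊆ I(Z₀)_δ` and thus we obtain a canonical `GL_{n²}`-equivariant surjection
`ℂ[Z]_δ ↠ ℂ[Z₀]_δ`. By Schur's lemma (Cor. 12.6) ...").

Formal proof, following this architecture with the tree's assets. `Z ⊆ Ω`, i.e.
`HasBorderDetRepr ℂ n m` transported to the lexicographic matrix variables
(`hasBorderDetRepr_iff_rename_holds`, file `SchurWeylPlethysmRenameProofs`), gives the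
inclusion of orbit ideals `I(GL · det_m) ≤ I(GL · X₀₀^{m-n} per_n)`
(`orbitVanishingIdeal_le_of_mem_orbitClosure`, file `GCTObstructions`) and with it the
`GL`-equivariant surjective restriction `ℂ[Ω] ↠ ℂ[Z]` (the factor map `Ideal.quotientMapₐ`, which is
`orbitCoordRestrict` of `GCTObstructions` by definition, bundled here as an intertwining map exactly
as in `orbitMultiplicity_le_of_mem_orbitClosure_holds`); `ℂ[Ω] = ℂ[Sym^m]/I(GL · det_m)` is a completely
reducible `GL_{m²}`-representation in characteristic zero
(`isSemisimpleRepresentation_orbitCoordRep`, file `MultiplicityObstructionsProofs`, from Schur–Weyl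
duality), so highest-weight vectors lift along the surjection (`hasHighestWeight_of_surjective`,
same file: the kernel has a stable complement mapping isomorphically onto the target). The lift is
recorded for arbitrary forms `f, g` over any field of characteristic zero and any finite linearly
ordered variable type, in the ideal form `I(GL · f) ≤ I(GL · g)`
(`hasHighestWeight_orbitCoordRep_of_le`) and in the orbit-closure form `g ∈ Δ[f]`
(`hasHighestWeight_orbitCoordRep_of_mem_orbitClosure`).

## Sources

* P. Bürgisser, C. Ikenmeyer, G. Panova, *No occurrence obstructions in geometric complexity
  theory*, J. AMS 32 (2019) 163–193 = arXiv:1604.06431v3, §1 (p. 3), Conj. 1.3, Thm. 1.4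
  (key `BurgisserIkenmeyerPanovaJAMS2019`; `BIP2019` is the interim stub key of the same paper used
  by the docstrings of `OccurrenceObstructions.lean`).
* P. Bürgisser, J. M. Landsberg, L. Manivel, J. Weyman, *An overview of mathematical issues arising
  in the geometric complexity theory approach to VP ≠ VNP*, SIAM J. Comput. 40 (2011)
  = arXiv:0907.2850, §1 (p. 3) (Prop. 3.3.2 of the journal version, as cited by
  `OccurrenceObstructions.lean`; locators verified here refer to the arXiv version)
  (key `BurgisserEtAl2011`; `BLMW2011` is the interim stub key of the same paper).
* M. Bläser, C. Ikenmeyer, *Introduction to Geometric Complexity Theory*, Theory of Computing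
  Graduate Surveys 10 (2025), §12.4 (p. 74), Cor. 12.6 (p. 72) (key `BlaeserIkenmeyer2025`).
* K. Mulmuley, M. Sohoni, *Geometric complexity theory II*, SIAM J. Comput. 38 (2008), §1
  (the occurrence-obstruction route).

## Tree

`orbitVanishingIdeal_le_of_mem_orbitClosure`, `orbitCoordSubst_mk` (`GCTObstructions.lean`,
`OrbitCoordinateRing.lean`); `isSemisimpleRepresentation_orbitCoordRep`, `hasHighestWeight_of_surjective`
(`MultiplicityObstructionsProofs.lean`); `hasBorderDetRepr_iff_rename_holds`
(`SchurWeylPlethysmRenameProofs.lean`). No definitions are introduced; no statement of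
`OccurrenceObstructions.lean` is changed.
-/

noncomputable section

open MvPolynomial

namespace Literature.Computability.Complexity

section Lift

variable {k : Type*} [Field k] {σ : Type*} [Fintype σ] [LinearOrder σ] {m : ℕ}

/-- **Highest weights lift along `k[Sym^m]/I ↠ k[Sym^m]/J` for orbit ideals `I ≤ J`**
(characteristic zero): if `I(GL · f) ≤ I(GL · g)` and `V(χ)` occurs in
`k[Δ_m[g]] = k[Sym^m]/I(GL · g)`, then `V(χ)` occurs in `k[Δ_m[f]]`. The factor map is a
`GL`-equivariant surjection out of the completely reducible `k[Δ_m[f]]`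
(`isSemisimpleRepresentation_orbitCoordRep`), along which highest-weight vectors lift
(`hasHighestWeight_of_surjective`). Bläser–Ikenmeyer 2025 §12.4 ("`I(Z)_δ ⊆ I(Z₀)_δ` and thus we
obtain a canonical equivariant surjection `ℂ[Z]_δ ↠ ℂ[Z₀]_δ`. By Schur's lemma (Cor. 12.6) ...");
BIP 2019 §1. [cite: BlaeserIkenmeyer2025, §12.4 with Cor. 12.6] -/
theorem hasHighestWeight_orbitCoordRep_of_le [CharZero k] {f g : MvPolynomial σ k}
    (hle : AlgebraicComplexity.orbitVanishingIdeal f m ≤ AlgebraicComplexity.orbitVanishingIdeal g m) {χ : Literature.NumberTheory.DiophantineGeometry.Weight σ}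
    (h : Literature.NumberTheory.DiophantineGeometry.HasHighestWeight (AlgebraicComplexity.orbitCoordRep g m) χ) : Literature.NumberTheory.DiophantineGeometry.HasHighestWeight (AlgebraicComplexity.orbitCoordRep f m) χ := by
  -- the factor map `k[Sym^m]/I → k[Sym^m]/J` (identity on representatives)
  let res : AlgebraicComplexity.OrbitCoordRing f m →ₐ[k] AlgebraicComplexity.OrbitCoordRing g m :=
    Ideal.quotientMapₐ (AlgebraicComplexity.orbitVanishingIdeal g m) (AlgHom.id k _) (by simpa using hle)
  have res_mk : ∀ F : MvPolynomial (AlgebraicComplexity.DegIdx σ m) k,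
      res (Ideal.Quotient.mk (AlgebraicComplexity.orbitVanishingIdeal f m) F) =
        Ideal.Quotient.mk (AlgebraicComplexity.orbitVanishingIdeal g m) F := fun F => rfl
  -- it is an equivariant surjection
  let π : (AlgebraicComplexity.orbitCoordRep f m).IntertwiningMap (AlgebraicComplexity.orbitCoordRep g m) :=
    { toLinearMap := res.toLinearMap
      isIntertwining' := fun A => by
        refine LinearMap.ext fun x => ?_
        obtain ⟨F, rfl⟩ := Ideal.Quotient.mk_surjective x
        simp only [LinearMap.coe_comp, Function.comp_apply, AlgHom.toLinearMap_apply,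
          AlgebraicComplexity.orbitCoordRep_apply, AlgebraicComplexity.orbitCoordSubst_mk, res_mk] }
  have hπ : Function.Surjective π := by
    intro y
    obtain ⟨F, rfl⟩ := Ideal.Quotient.mk_surjective y
    exact ⟨Ideal.Quotient.mk _ F, res_mk F⟩
  exact AlgebraicComplexity.hasHighestWeight_of_surjective π hπ (AlgebraicComplexity.isSemisimpleRepresentation_orbitCoordRep f m) h

/-- **Occurrence transports along orbit-closure containment** (characteristic zero): if
`g ∈ Δ[f]`, every irreducible `V(χ)` occurring in `k[Δ_m[g]]` occurs in `k[Δ_m[f]]`: then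
`I(GL · f) ≤ I(GL · g)` (`orbitVanishingIdeal_le_of_mem_orbitClosure`) and restriction
`k[Δ_m[f]] ↠ k[Δ_m[g]]` is a `GL`-equivariant surjection out of a completely reducible
representation (`hasHighestWeight_orbitCoordRep_of_le`). BIP 2019 §1 ("the restriction defines a surjective `G`-equivariant
homomorphism `ℂ[Ω_n] → ℂ[Z_{n,m}]` of the coordinate rings. Schur's lemma implies that if `λ`
occurs in `ℂ[Z_{n,m}]`, then it must also occur in `ℂ[Ω_n]`"); BLMW 2011 §1 (arXiv p. 3);
Bläser–Ikenmeyer 2025 §12.4.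
[cite: BurgisserIkenmeyerPanovaJAMS2019, §1 (arXiv:1604.06431v3 p. 3)] -/
theorem hasHighestWeight_orbitCoordRep_of_mem_orbitClosure [CharZero k] {f g : MvPolynomial σ k}
    (hmem : g ∈ AlgebraicComplexity.orbitClosure f) {χ : Literature.NumberTheory.DiophantineGeometry.Weight σ}
    (h : Literature.NumberTheory.DiophantineGeometry.HasHighestWeight (AlgebraicComplexity.orbitCoordRep g m) χ) : Literature.NumberTheory.DiophantineGeometry.HasHighestWeight (AlgebraicComplexity.orbitCoordRep f m) χ :=
  hasHighestWeight_orbitCoordRep_of_le (AlgebraicComplexity.orbitVanishingIdeal_le_of_mem_orbitClosure hmem) h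

end Lift

end Literature.Computability.Complexity

namespace Literature.Computability.Complexity

/-- **The occurrence-obstruction principle** (discharge of
`Literature.Computability.Complexity.not_hasBorderDetRepr_of_hasHighestWeight_of_not`): over `ℂ`, if some irreducible `V(χ)` of
`GL_{m²}` occurs in `ℂ[\overline{GL · X₀₀^{m-n} per_n}]` (`paddedPerOrbitRep`) but not in
`ℂ[\overline{GL · det_m}]` (`detOrbitRep`), then `X₀₀^{m-n} per_n ∉ \overline{GL_{m²} · det_m}`,
i.e. `¬ HasBorderDetRepr ℂ n m`. Proof as printed: containment of the padded permanent in `Ω`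
(transported to the lexicographic variables, `hasBorderDetRepr_iff_rename_holds`) gives the
equivariant surjective restriction `ℂ[Ω] ↠ ℂ[Z]`, along which occurrence lifts by complete
reducibility of `ℂ[Ω]` (`hasHighestWeight_orbitCoordRep_of_mem_orbitClosure`). BIP 2019 §1
(arXiv:1604.06431v3 p. 3); BLMW 2011 §1 (arXiv:0907.2850 p. 3); Mulmuley–Sohoni 2008 §1–3.
[cite: BurgisserIkenmeyerPanovaJAMS2019, §1 (arXiv:1604.06431v3 p. 3)] -/
theorem not_hasBorderDetRepr_of_hasHighestWeight_of_not_holds :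
    not_hasBorderDetRepr_of_hasHighestWeight_of_not := by
  intro n m _ χ h₁ h₂ hB
  exact h₂ (Complexity.hasHighestWeight_orbitCoordRep_of_mem_orbitClosure
    ((Literature.NumberTheory.DiophantineGeometry.hasBorderDetRepr_iff_rename_holds n m).mp hB) h₁)

/-- The predicate form `IsOccurrenceObstruction.not_hasBorderDetRepr` of the principle (named fact
of `OccurrenceObstructions.lean`, there attributed to BLMW 2011 Prop. 3.3.2 in the journal
numbering; arXiv:0907.2850 §1, p. 3), discharged from
`not_hasBorderDetRepr_of_hasHighestWeight_of_not_holds` by the preserved interim proof.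
[cite: BurgisserEtAl2011, §1 (arXiv:0907.2850 p. 3)] -/
theorem IsOccurrenceObstruction.not_hasBorderDetRepr_holds :
    IsOccurrenceObstruction.not_hasBorderDetRepr := fun h =>
  not_hasBorderDetRepr_of_hasHighestWeight_of_not_holds _ _ _ h.1 h.2

/-- Discharge of `mulmuleySohoni_of_occurrenceObstructionRoute`: the occurrence-obstruction route
implies the Mulmuley–Sohoni conjecture in the quantifier shape of
`Literature.Computability.AlgebraicComplexity.MulmuleySohoniConjecture` (preserved interim proof: immediate from the principle).
Mulmuley–Sohoni 2008 §1; BLMW 2011 §1; BIP 2019 §1 (Conj. 1.3 and the paragraph before it). [cite: BurgisserIkenmeyerPanovaJAMS2019, §1 (Conj. 1.3)] -/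
theorem mulmuleySohoni_of_occurrenceObstructionRoute_holds :
    mulmuleySohoni_of_occurrenceObstructionRoute := by
  intro h c
  obtain ⟨n₀, hn₀⟩ := h c
  refine ⟨n₀, fun n hn m _ hnm hmc => ?_⟩
  obtain ⟨χ, hχ⟩ := hn₀ n hn m hnm hmc
  exact IsOccurrenceObstruction.not_hasBorderDetRepr_holds hχ

/-- Conditional form of `lt_borderDetComplexityPer_of_occurrence_obstruction` (its preserved
interim proof, given the nonemptiness `CplxAlg.exists_hasBorderDetRepr` of the set defining
`\underline{dc}(per_n) = borderDetComplexityPer ℂ n`, a named fact of `OrbitClosure.lean` resting on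
Valiant universality): if an occurrence obstruction exists at every determinant size `m'` with
`n ≤ m' ≤ m`, then `m < \underline{dc}(per_n)` — the infimum `m' = \underline{dc}(per_n)` satisfies
`n ≤ m'` and `HasBorderDetRepr ℂ n m'`, so `m' ≤ m` would contradict the principle.
Mulmuley–Sohoni 2001 §4 (`\underline{dc}`); BIP 2019 §1.
[cite: BurgisserIkenmeyerPanovaJAMS2019, §1 (arXiv:1604.06431v3 p. 3)] -/
theorem lt_borderDetComplexityPer_of_occurrence_obstruction_of_exists
    (hex : AlgebraicComplexity.exists_hasBorderDetRepr (k := ℂ)) :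
    lt_borderDetComplexityPer_of_occurrence_obstruction := by
  intro n m h
  by_contra hle
  push Not at hle
  obtain ⟨hpos, hdc, hrepr⟩ := Nat.sInf_mem (hex n)
  haveI : NeZero (AlgebraicComplexity.borderDetComplexityPer ℂ n) := NeZero.of_pos hpos
  obtain ⟨χ, hχ⟩ := h (AlgebraicComplexity.borderDetComplexityPer ℂ n) hdc hle
  exact IsOccurrenceObstruction.not_hasBorderDetRepr_holds hχ hrepr

/-- Conditional form of `not_isOccurrenceObstruction` (its preserved interim proof): BIP's
Theorem 1.4 in the weight form `no_occurrence_obstructions` excludes occurrence obstructions once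
`n ^ 25 ≤ m`, `0 < n`. BIP 2019, Thm. 1.4 ("In particular, Conjecture 1.3 is false").
[cite: BurgisserIkenmeyerPanovaJAMS2019, Thm. 1.4] -/
theorem not_isOccurrenceObstruction_of_no_occurrence_obstructions
    (hBIP : no_occurrence_obstructions) : not_isOccurrenceObstruction :=
  fun hn hnm χ h => h.2 (hBIP _ _ hn hnm χ h.1)

/-- Conditional form of `not_occurrenceObstructionRoute` (its preserved interim proof): BIP's
Theorem 1.4 in the weight form `no_occurrence_obstructions` kills the occurrence-obstruction route
(`c = 25`, `n = max n₀ 1`, `m = n ^ 25`). BIP 2019, Thm. 1.4 and the discussion after Conj. 1.3.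
[cite: BurgisserIkenmeyerPanovaJAMS2019, Thm. 1.4] -/
theorem not_occurrenceObstructionRoute_of_no_occurrence_obstructions
    (hBIP : no_occurrence_obstructions) : not_occurrenceObstructionRoute := by
  intro h
  obtain ⟨n₀, hn₀⟩ := h 25
  set n := max n₀ 1
  have hn : 0 < n := lt_of_lt_of_le Nat.one_pos (le_max_right _ _)
  haveI : NeZero (n ^ 25) := NeZero.of_pos (Nat.pow_pos hn)
  obtain ⟨χ, hχ⟩ := hn₀ n (le_max_left _ _) (n ^ 25) (Nat.le_self_pow (by norm_num) n) le_rfl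
  exact not_isOccurrenceObstruction_of_no_occurrence_obstructions hBIP hn le_rfl χ hχ

end Literature.Computability.Complexity
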